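import Summits.Ventures.GridStability.Lyapunov.RelativeLffClosedFormLines
import Summits.Ventures.GridStability.Lyapunov.WSCC9LffRoa
import Summits.Ventures.GridStability.Models.LineAngleTables
import HarnessLib

/-!
# GridStability/Lyapunov/WSCC9LffLevel — LFF P1 with EXPLICIT RATIONAL LEVELS: «WSCC9 lossless uniform-λ
# variant», the certificate of record (6 ordered pairs) and the 3-line closed form, every λ

Cell `gridfusion` (LADDER-GRIDFUSION), LFF lane «explicit rational level» — the WSCC9 item left open by
lyap-1 g3 (INBOX 2026-08-27T03:48:49Z «open items for the successor lyap-1 … WSCC9 level»), written by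
gridfusion-model-1 (g4) on its own tables (`Models/LineAngleBounds.lean` p491061,
`Models/LineAngleTables.lean` p492027) and lyap-1's generic machinery (`RelativeLffClosedFormLines.lean`
p493112: `certU`, `levelBoundQ`, `wellU_subset_regionOfAttraction_of_level`, `synchronisationU_of_level`);
namespace `Summit.Ventures.GridStability.Lyapunov.WSCC9Lff` (continued from `WSCC9LffRoa.lean` p487113).
LABEL OF EVERY MENTION (lead): «synthetic lossless uniform-λ VARIANT of the printed 9-bus (transfer
conductances K^G dropped) — a PIPELINE demonstration, not a 9-bus sentence»; tokens MV-2L synthetic +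
MV-RD + MV-λ + MV-h12.

CERTIFIED HERE (kernel):
(A) THE CERTIFICATE OF RECORD P1 (`WSCC9Lff.cert lam`, p487113, six ORDERED pairs, weights `C_ij/2`): its
  symbolic level hypothesis `∀ k, c₀ < V(0) + c′·w_k·vtGap(θ*_k)` holds for EVERY
  `c₀ < (2/λ + λ/2)·(1657/10000 − 72029/20000) = −c′ · 3.43575` (`cert_hc₀_of_level`, from model-1's
  certified aggregates `WSCC9.closedForm_level_pair` and lit-6's `Certificate.V_zero`; exact supremum
  ≈ −c′·3.43567); hence `level_roa` / `level_synchronisation` = p487113's two sentences with that explicit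
  level (`λ = 1/10`: every `c₀ ≤ −68.89`).
(B) THE 3-LINE CLOSED FORM (`certU lam`, unordered lines, full weights `C_ij`, lyap-1's `RelativeLff.certU`
  with Sherman–Morrison `N⁻¹` and `ν = 1/80`): node tables = model-1's `WSCC9.angleLo/angleHi` (their
  decidable tests restated as `lo_test`/`hi_test`), ONE rational `L_U = −327/100` below every line's
  `levelBoundQ` (exact supremum ≈ −3.26988; `decide`), hence `levelU_roa` / `levelU_synchronisation` for
  EVERY `λ > 0` and EVERY `c₀ < (2/λ + λ/2)·L_U` (`λ = 1/10`: every `c₀ ≤ −65.57`) — the lines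
  presentation credits the full line gap and certifies the higher level.
THREE COLUMNS. CERTIFIED: the rational facts and the four sentences, for MODEL M′ = `WSCC9.postB_relL`.
MODELLED: as in `WSCC9LffRoa.lean`. VALIDATED: nothing. No sentence of this file says that the WSCC 9-bus
system or any grid is stable. Definitions: `L_U`, `certU` (bookkeeping); no named fact; standard axioms.
-/

noncomputable section

open Set Filter Topology Real
open Literature.MathematicalPhysics.PowerSystems
open Literature.MathematicalPhysics.PowerSystems.LyapunovFunctionFamily
open Literature.MathematicalPhysics.PowerSystems.ClassicalModel.LosslessSystem (vtGap)
open Summit.Ventures.GridStability.Models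
open Summit.Ventures.GridStability.Lyapunov.RelativeLff

namespace Summit.Ventures.GridStability.Lyapunov.WSCC9Lff

/-! ### (A) The certificate of record (ordered pairs): explicit level -/

/-- **The symbolic level hypothesis of p487113 discharged**: for every `λ > 0` and every
`c₀ < (2/λ + λ/2)·(1657/10000 − 72029/20000)`, `c₀ < V(0) + c′·w_k·vtGap(θ*_k)` on all six ordered pairs
(model-1's `WSCC9.closedForm_level_pair` + lit-6's `Certificate.V_zero`). -/
theorem cert_hc₀_of_level (lam : ℚ) (hlam : 0 < lam) {c₀ : ℝ}
    (hc₀ : c₀ < (2 / (lam : ℝ) + (lam : ℝ) / 2) * ((1657 : ℝ) / 10000 - 72029 / 20000))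
    (k : RecastData.LffPair 2) :
    c₀ < (cert lam hlam).V 0
      + (2 / (lam : ℝ) + (lam : ℝ) / 2) * WSCC9.postB_relL.lffWo k
        * vtGap (RecastData.lffδso WSCC9.postB_relL.angleOf k) := by
  have hlam' : (0 : ℝ) < lam := by exact_mod_cast hlam
  have hcp : (0 : ℝ) ≤ 2 / (lam : ℝ) + (lam : ℝ) / 2 := by positivity
  have h := WSCC9.closedForm_level_pair (2 / (lam : ℝ) + (lam : ℝ) / 2) hcp k
  rw [Certificate.V_zero]
  show c₀ < -(∑ k' : RecastData.LffPair 2, (2 / (lam : ℝ) + (lam : ℝ) / 2) * WSCC9.postB_relL.lffWo k' *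
      (Real.cos (RecastData.lffδso WSCC9.postB_relL.angleOf k')
        + RecastData.lffδso WSCC9.postB_relL.angleOf k' * Real.sin (RecastData.lffδso WSCC9.postB_relL.angleOf k')))
    + (2 / (lam : ℝ) + (lam : ℝ) / 2) * WSCC9.postB_relL.lffWo k
      * vtGap (RecastData.lffδso WSCC9.postB_relL.angleOf k)
  linarith

/-- **P1 of record with an EXPLICIT level** (region sentence of p487113): for every `λ > 0`, every
`c₀ < (2/λ + λ/2)·(1657/10000 − 72029/20000)` (`λ = 1/10`: every `c₀ ≤ −68.89`) and every `y ∈ 𝒫` with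
`V y ≤ c₀`: a global solution exists and EVERY global solution keeps `{𝒫, V ≤ c₀}` and tends to `0`.
MODELLED: synthetic lossless uniform-λ variant. [cite: VuTuritsyn2016, §IV set ℛ] -/
theorem level_roa (lam : ℚ) (hlam : 0 < lam) {c₀ : ℝ}
    (hc₀ : c₀ < (2 / (lam : ℝ) + (lam : ℝ) / 2) * ((1657 : ℝ) / 10000 - 72029 / 20000))
    {y : Fin 2 ⊕ Fin 2 → ℝ}
    (hy : y ∈ (System.relativeSwing (fun m : Fin 2 => ((WSCC9.postB_relL.M m.succ : ℚ) : ℝ))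
      ((WSCC9.postB_relL.M 0 : ℚ) : ℝ) (lam : ℝ) (RecastData.lffEo 2) WSCC9.postB_relL.lffWo
      (RecastData.lffδso WSCC9.postB_relL.angleOf)).polytope)
    (hyc : (cert lam hlam).V y ≤ c₀) :
    (∃ X : ℝ → Fin 2 ⊕ Fin 2 → ℝ, X 0 = y ∧
        ∀ T : ℝ, ∀ t ∈ Icc 0 T, HasDerivWithinAt X
          ((System.relativeSwing (fun m : Fin 2 => ((WSCC9.postB_relL.M m.succ : ℚ) : ℝ))
      ((WSCC9.postB_relL.M 0 : ℚ) : ℝ) (lam : ℝ) (RecastData.lffEo 2) WSCC9.postB_relL.lffWo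
      (RecastData.lffδso WSCC9.postB_relL.angleOf)).field (X t)) (Icc 0 T) t) ∧
      ∀ X : ℝ → Fin 2 ⊕ Fin 2 → ℝ, X 0 = y →
        (∀ T : ℝ, ∀ t ∈ Icc 0 T, HasDerivWithinAt X
          ((System.relativeSwing (fun m : Fin 2 => ((WSCC9.postB_relL.M m.succ : ℚ) : ℝ))
      ((WSCC9.postB_relL.M 0 : ℚ) : ℝ) (lam : ℝ) (RecastData.lffEo 2) WSCC9.postB_relL.lffWo
      (RecastData.lffδso WSCC9.postB_relL.angleOf)).field (X t)) (Icc 0 T) t) →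
        (∀ t, 0 ≤ t → X t ∈ (System.relativeSwing (fun m : Fin 2 => ((WSCC9.postB_relL.M m.succ : ℚ) : ℝ))
      ((WSCC9.postB_relL.M 0 : ℚ) : ℝ) (lam : ℝ) (RecastData.lffEo 2) WSCC9.postB_relL.lffWo
      (RecastData.lffδso WSCC9.postB_relL.angleOf)).polytope ∧ (cert lam hlam).V (X t) ≤ c₀) ∧
          Tendsto X atTop (𝓝 0) :=
  wscc9Lff_well_subset_regionOfAttraction lam hlam (cert_hc₀_of_level lam hlam hc₀) hy hyc

/-- **P1 of record with an EXPLICIT level, read on model-1's typed classical model** (synchronisation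
sentence of p487113): every solution of `postB_relL.toModelRel lam a′` on `univ` whose initial relative
state lies in `{𝒫, V ≤ c₀}`, `c₀ < (2/λ + λ/2)·(1657/10000 − 72029/20000)`, keeps it and synchronises with
machine 1. [cite: VuTuritsyn2016, §IV set ℛ; SauerPai1998, §6.10 eqs. (6.238)–(6.241)] -/
theorem level_synchronisation (lam : ℚ) (hlam : 0 < lam) (a : ℝ) {c₀ : ℝ}
    (hc₀ : c₀ < (2 / (lam : ℝ) + (lam : ℝ) / 2) * ((1657 : ℝ) / 10000 - 72029 / 20000))
    {c : ℝ → ClassicalSwing.State 3}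
    (hc : (WSCC9.postB_relL.toModelRel lam a).IsSolutionOn c univ)
    (hy : RecastData.lffState WSCC9.postB_relL.angleOf (c 0) ∈
      (System.relativeSwing (fun m : Fin 2 => ((WSCC9.postB_relL.M m.succ : ℚ) : ℝ))
      ((WSCC9.postB_relL.M 0 : ℚ) : ℝ) (lam : ℝ) (RecastData.lffEo 2) WSCC9.postB_relL.lffWo
      (RecastData.lffδso WSCC9.postB_relL.angleOf)).polytope)
    (hyc : (cert lam hlam).V (RecastData.lffState WSCC9.postB_relL.angleOf (c 0)) ≤ c₀) :
    (∀ t, 0 ≤ t →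
        RecastData.lffState WSCC9.postB_relL.angleOf (c t) ∈
            (System.relativeSwing (fun m : Fin 2 => ((WSCC9.postB_relL.M m.succ : ℚ) : ℝ))
      ((WSCC9.postB_relL.M 0 : ℚ) : ℝ) (lam : ℝ) (RecastData.lffEo 2) WSCC9.postB_relL.lffWo
      (RecastData.lffδso WSCC9.postB_relL.angleOf)).polytope ∧
          (cert lam hlam).V (RecastData.lffState WSCC9.postB_relL.angleOf (c t)) ≤ c₀) ∧
      Tendsto (fun t => RecastData.lffState WSCC9.postB_relL.angleOf (c t)) atTop (𝓝 0) :=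
  synchronisation_of_isSolutionOn lam hlam a (cert_hc₀_of_level lam hlam hc₀) hc hy hyc

/-! ### (B) The 3-line closed form (`certU`, lyap-1's generic machinery), explicit level -/

/-- All inertias positive. -/
theorem M_pos : ∀ i : Fin 3, 0 < WSCC9.postB_relL.M i := by decide +kernel

/-- The PSD margin `ν = 1/80` lies below both non-reference inertias (`M₂ ≈ 0.0340`, `M₃ ≈ 0.0160`). -/
theorem nu_lt_Mμ : ∀ m : Fin 2, (1 / 80 : ℝ) < Mμ WSCC9.postB_relL m := by
  have hq : ∀ m : Fin 2, (1 / 80 : ℚ) < WSCC9.postB_relL.M m.succ := by decide +kernel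
  intro m
  unfold Mμ
  rw [show (1 / 80 : ℝ) = ((1 / 80 : ℚ) : ℝ) by norm_num]
  exact_mod_cast hq m

/-- Sherman–Morrison PSD criterion at `ν = 1/80`: `Σ_m M′_m²/(M′_m − ν) ≤ S` (`0.12726 ≤ 0.17533`). -/
theorem cs_criterion :
    ∑ m, Mμ WSCC9.postB_relL m ^ 2 / (Mμ WSCC9.postB_relL m - 1 / 80) ≤ S WSCC9.postB_relL := by
  have hq : ∑ m : Fin 2, WSCC9.postB_relL.M m.succ ^ 2 / (WSCC9.postB_relL.M m.succ - 1 / 80)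
      ≤ WSCC9.postB_relL.M 0 + ∑ m : Fin 2, WSCC9.postB_relL.M m.succ := by decide +kernel
  have h := (Rat.cast_le (K := ℝ)).2 hq
  unfold S Mμ Mref
  push_cast at h
  exact h

/-- model-1's lower node table passes its own decidable tests (restated in the form lyap-1's API takes). -/
theorem lo_test : ∀ i, WSCC9.angleLo i ≤ 0 ∨
    AngleEnclosure.lowerTest (WSCC9.postB_relL.c i) (WSCC9.angleLo i) = true := by
  decide +kernel

/-- … and the upper node table. -/
theorem hi_test : ∀ i, (WSCC9.postB_relL.c i = 1 ∧ 0 ≤ WSCC9.angleHi i) ∨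
    AngleEnclosure.upperTest (WSCC9.postB_relL.c i) (WSCC9.angleHi i) = true := by
  decide +kernel

/-- The level constant of the 3-line closed form: `L_U = −3.27` (exact supremum ≈ −3.26988). -/
def L_U : ℚ := -327 / 100

/-- `L_U` lies below every line's rational level functional (weights `C_ij`). -/
theorem L_U_le : ∀ k, L_U ≤ levelBoundQ WSCC9.postB_relL (wuq WSCC9.postB_relL) WSCC9.angleLo WSCC9.angleHi k := by
  decide +kernel

/-- The closed-form certificate on the 3-line presentation `WSCC9.lffSystemU lam` (= `postB_relL.lffSystemU
lam angleOf`), every `λ > 0`, `ν = 1/80`. [cite: VuTuritsyn2016, §III eq. (QKH)] -/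
def certU (lam : ℚ) (hlam : 0 < lam) :=
  RelativeLff.certU WSCC9.postB_relL lam hlam WSCC9.postB_relL.angleOf (ν := 1 / 80) (by norm_num) M_pos
    nu_lt_Mμ cs_criterion WSCC9.postB_relL_Cc_pos

/-- **Explicit-level region, 3-line closed form, every `λ > 0`**: for every `c₀ < (2/λ + λ/2)·L_U`
(`λ = 1/10`: every `c₀ ≤ −65.57`) and every `y ∈ 𝒫` with `V_λ y ≤ c₀`: a global solution of
`WSCC9.lffSystemU lam` exists and EVERY global solution keeps `{𝒫, V_λ ≤ c₀}` and tends to `0`.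
MODELLED: synthetic lossless uniform-λ variant. [cite: VuTuritsyn2016, §IV set ℛ] -/
theorem levelU_roa (lam : ℚ) (hlam : 0 < lam) {c₀ : ℝ}
    (hc₀ : c₀ < (2 / (lam : ℝ) + (lam : ℝ) / 2) * (L_U : ℝ)) {y : Fin 2 ⊕ Fin 2 → ℝ}
    (hy : y ∈ (WSCC9.postB_relL.lffSystemU lam WSCC9.postB_relL.angleOf).polytope)
    (hyc : (certU lam hlam).V y ≤ c₀) :
    (∃ X : ℝ → Fin 2 ⊕ Fin 2 → ℝ, X 0 = y ∧
        ∀ T : ℝ, ∀ t ∈ Icc 0 T, HasDerivWithinAt X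
          ((WSCC9.postB_relL.lffSystemU lam WSCC9.postB_relL.angleOf).field (X t)) (Icc 0 T) t) ∧
      ∀ X : ℝ → Fin 2 ⊕ Fin 2 → ℝ, X 0 = y →
        (∀ T : ℝ, ∀ t ∈ Icc 0 T, HasDerivWithinAt X
          ((WSCC9.postB_relL.lffSystemU lam WSCC9.postB_relL.angleOf).field (X t)) (Icc 0 T) t) →
        (∀ t, 0 ≤ t → X t ∈ (WSCC9.postB_relL.lffSystemU lam WSCC9.postB_relL.angleOf).polytope ∧
            (certU lam hlam).V (X t) ≤ c₀) ∧
          Tendsto X atTop (𝓝 0) :=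
  wellU_subset_regionOfAttraction_of_level WSCC9.postB_relL lam hlam _ M_pos nu_lt_Mμ cs_criterion
    WSCC9.postB_relL_Cc_pos WSCC9.postB_relL_eqData WSCC9.postB_relL_circle.1 WSCC9.postB_relL_s_nonneg
    WSCC9.postB_relL_c_pos WSCC9.angleLo WSCC9.angleHi lo_test hi_test L_U_le hc₀ hy hyc

/-- **Explicit-level synchronisation, 3-line closed form, every `λ > 0`**, read on
`WSCC9.postB_relL.toModelRel lam a′` (hypothesis-free: lossless variant, reciprocal, exact A1 data): every
solution whose initial relative state lies in `{𝒫, V_λ ≤ c₀}`, `c₀ < (2/λ + λ/2)·L_U`, keeps it and has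
`(δ_m − δ_1) − θ*_m → 0`, `ω_m − ω_1 → 0`. [cite: VuTuritsyn2016, §IV set ℛ; SauerPai1998, §6.10] -/
theorem levelU_synchronisation (lam : ℚ) (hlam : 0 < lam) (a : ℝ) {c₀ : ℝ}
    (hc₀ : c₀ < (2 / (lam : ℝ) + (lam : ℝ) / 2) * (L_U : ℝ)) {c : ℝ → ClassicalSwing.State 3}
    (hsol : (WSCC9.postB_relL.toModelRel lam a).IsSolutionOn c univ)
    (hy : RecastData.lffState WSCC9.postB_relL.angleOf (c 0) ∈
      (WSCC9.postB_relL.lffSystemU lam WSCC9.postB_relL.angleOf).polytope)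
    (hyc : (certU lam hlam).V (RecastData.lffState WSCC9.postB_relL.angleOf (c 0)) ≤ c₀) :
    (∀ t, 0 ≤ t → RecastData.lffState WSCC9.postB_relL.angleOf (c t) ∈
          (WSCC9.postB_relL.lffSystemU lam WSCC9.postB_relL.angleOf).polytope ∧
          (certU lam hlam).V (RecastData.lffState WSCC9.postB_relL.angleOf (c t)) ≤ c₀) ∧
      Tendsto (fun t => RecastData.lffState WSCC9.postB_relL.angleOf (c t)) atTop (𝓝 0) :=
  synchronisationU_of_level WSCC9.postB_relL lam hlam a WSCC9.postB_relL_transferConductance_eq_zero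
    WSCC9.postB_relL_B_symm _ M_pos nu_lt_Mμ cs_criterion WSCC9.postB_relL_Cc_pos WSCC9.postB_relL_eqData
    WSCC9.postB_relL_circle.1 WSCC9.postB_relL_s_nonneg WSCC9.postB_relL_c_pos WSCC9.angleLo WSCC9.angleHi
    lo_test hi_test L_U_le hc₀ hsol hy hyc

end Summit.Ventures.GridStability.Lyapunov.WSCC9Lff

end
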